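import Summits.BirchSwinnertonDyer.Rank1Residual.X11b.Three.LambdaSupplyCharacters
import Literature.NumberTheory.GaloisRepresentations.EverywhereUnramifiedAlgebraicHeckeCharacter
import Literature.NumberTheory.EllipticCurves.HeegnerPoints
import HarnessLib

set_option linter.dupNamespace false
set_option autoImplicit false

/-!
# Crux `EisensteinHeartFlatCMInertBadKPrime` (stmt-BirchSwinnertonDyer-21341), line `hsieh_lambda` v7 — stub R1
# `stub_rangeCharacter`: an everywhere-unramified Hecke character of type `(k, −k)` on any imaginary quadratic field

Lead seat `bsd-wall-cm-bed-p1` g11 (`--supports stmt-BirchSwinnertonDyer-21341`; theorems only; nothing is closed; BSD is not proved).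

The idelic half of «Hsieh's range on the `K′`-line is non-empty» (skeleton v7, sha16 7a0fae088e9a9fa9): for every imaginary
quadratic field `K` there is a (unitary) Hecke character `Ψ` of infinity type `(w_K, −w_K)` — tree convention
`HasInfinityType (fun _ ↦ w_K) (fun _ ↦ -w_K)`, i.e. `Ψ((x, 1)) = ι(x)^{-w_K} · \overline{ι(x)}^{w_K}` — UNRAMIFIED AT EVERY FINITE
PLACE, where `w_K = NumberField.Units.torsionOrder K` is the number of roots of unity of `K`.

Proof: Weil's extension lemma with the finite-level conclusion kept (`HeckeCharacter.exists_isUnitary_infiniteIdeles_eq_unramified`,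
PROVED in `CMTypeHeckeCharacter`) for the MODULUS `⊤` and the unitary archimedean character `Φ(x) = (ι(x)/|ι(x)|)^{-2 w_K}`
(`exists_continuousMonoidHom_archUnitaryValue`): its unit hypothesis asks `Φ((u)_∞) = 1` for ALL units `u`, which holds because the
units of an imaginary quadratic field are roots of unity of order dividing `w_K` (`HeckeCharacter.units_pow_torsionOrder_eq_one`) of
absolute value `1` (`LambdaSupply.apply_units_eq_one`); the resulting `Ψ` is unramified at every `v` (`¬ ⊤ ≤ v`), and
`(z/|z|)^{-2w} = z^{-w} z̄^{w}` (`archUnitaryValue_neg_two_mul_eq`) is the type `(w_K, −w_K)`. Template: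
`LambdaSupply.exists_character_quotient_type_one` (modulus `(p²)`, type `(0, −1)`).

References: [Weil1956] §1; [deShalit1987] II.1.4 Lemma (ii); [Patrikis2019] Lemma 2.1.1.
-/

noncomputable section

open scoped NumberField ComplexConjugate
open NumberField NumberField.InfinitePlace NumberField.InfinitePlace.Completion IsDedekindDomain Filter Topology
  Literature.NumberTheory.GaloisRepresentations Literature.NumberTheory.EllipticCurves
  Summit.BirchSwinnertonDyer.Rank1Residual.X11b.Three.LambdaSupply

namespace Summit.BirchSwinnertonDyer.BirchSwinnertonDyer.Theorems.BiquadraticEisensteinDescentEisensteinHeartFlatCMInertBadKPrimeRangeCharacter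

/-- The archimedean value behind the type computation: `(z/|z|)^{-2w} · |z|^{0·i} = z^{-w} · z̄^{w}` for `z ≠ 0`
(`z z̄ = |z|²`). [folklore] -/
theorem archUnitaryValue_neg_two_mul_eq {z : ℂ} (hz : z ≠ 0) (w : ℕ) :
    archUnitaryValue (-(2 * (w : ℤ))) 0 z = z ^ (-(w : ℤ)) * conj z ^ (w : ℤ) := by
  have hr : ((‖z‖ : ℝ) : ℂ) ≠ 0 := by exact_mod_cast norm_ne_zero_iff.mpr hz
  have hconj : conj z = ((‖z‖ : ℝ) : ℂ) ^ 2 / z := by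
    rw [eq_div_iff hz, ← Complex.conj_mul']
  rw [archUnitaryValue, Complex.ofReal_zero, zero_mul, Complex.cpow_zero, mul_one, hconj,
    show (-(2 * (w : ℤ)) : ℤ) = -((2 * w : ℕ) : ℤ) by push_cast; ring, zpow_neg, zpow_natCast, zpow_neg, zpow_natCast,
    zpow_natCast, div_pow, div_pow, ← pow_mul]
  field_simp
  ring

/-- **An everywhere-unramified unitary Hecke character of infinity type `(w_K, −w_K)` on an imaginary quadratic field**
(`w_K = #μ(K)`): Weil's extension lemma for the modulus `⊤` and `Φ = (ι/|ι|)^{-2 w_K}` (units are roots of unity, killed by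
`w_K`). See the module docstring. [cite: Weil1956, §1] [cite: deShalit1987, II.1.4 Lemma (ii)] -/
theorem exists_isUnitary_hasInfinityType_torsionOrder_unramified {K : Type} [Field K] [NumberField K]
    (hK : IsImaginaryQuadratic K) :
    ∃ Ψ : HeckeCharacter K, Ψ.IsUnitary ∧
      Ψ.HasInfinityType (fun _ ↦ (Units.torsionOrder K : ℤ)) (fun _ ↦ -(Units.torsionOrder K : ℤ)) ∧
      ∀ v : HeightOneSpectrum (𝓞 K), Ψ.IsUnramifiedAt v := by
  classical
  haveI : IsTotallyComplex K := hK.2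
  haveI := subsingleton_infinitePlace hK.1
  set w : ℕ := Units.torsionOrder K with hw
  -- the archimedean character `Φ(x) = (ι x_w/|ι x_w|)^{-2w}`
  obtain ⟨Φ, hΦ⟩ := exists_continuousMonoidHom_archUnitaryValue (K := K) (fun _ => -(2 * (w : ℤ))) (fun _ => 0)
  have h0 : ∀ (x : (InfiniteAdeleRing K)ˣ) (v : InfinitePlace K),
      extensionEmbedding v ((x : InfiniteAdeleRing K) v) ≠ 0 :=
    fun x v => InfiniteIdele.extensionEmbedding_apply_ne_zero x v
  have hΦu : ∀ x, ‖(Φ x : ℂ)‖ = 1 := fun x => by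
    rw [hΦ x, norm_prod]
    exact Finset.prod_eq_one fun v _ => norm_archUnitaryValue (h0 x v) _ _
  -- the modulus `⊤` and Weil's unit hypothesis (all units are roots of unity)
  have h𝔞 : (⊤ : Ideal (𝓞 K)) ≠ ⊥ := top_ne_bot
  have hker : ∀ u : (𝓞 K)ˣ, (u : 𝓞 K) - 1 ∈ (⊤ : Ideal (𝓞 K)) →
      Φ (globalToInfiniteUnits K (Units.map (algebraMap (𝓞 K) K : 𝓞 K →* K) u)) = 1 := by
    intro u _
    obtain ⟨v₀⟩ : Nonempty (InfinitePlace K) := inferInstance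
    apply Units.ext
    have hemb : extensionEmbedding v₀
        ((globalToInfiniteUnits K (Units.map (algebraMap (𝓞 K) K : 𝓞 K →* K) u) : InfiniteAdeleRing K) v₀) =
        v₀.embedding ((u : 𝓞 K) : K) := by
      rw [val_globalToInfiniteUnits, InfiniteAdeleRing.algebraMap_apply]
      exact extensionEmbedding_coe v₀ (WithAbs.toAbs v₀.1 ((u : 𝓞 K) : K))
    have hnorm : ‖v₀.embedding ((u : 𝓞 K) : K)‖ = 1 := by
      rw [InfinitePlace.norm_embedding_eq]; exact apply_units_eq_one hK.1 v₀ u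
    have hpow : v₀.embedding ((u : 𝓞 K) : K) ^ w = 1 := by
      have h := HeckeCharacter.units_pow_torsionOrder_eq_one hK.1 u
      have h' : (((u : 𝓞 K) : K)) ^ w = 1 := by
        have := congrArg (fun x : (𝓞 K)ˣ ↦ ((x : 𝓞 K) : K)) h
        simpa using this
      rw [← map_pow, h', map_one]
    rw [hΦ, Fintype.prod_subsingleton _ v₀, hemb, Units.val_one, archUnitaryValue, hnorm, Complex.ofReal_one, div_one,
      Complex.one_cpow, mul_one, show (-(2 * (w : ℤ)) : ℤ) = -((2 * w : ℕ) : ℤ) by push_cast; ring, zpow_neg, zpow_natCast,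
      pow_mul', hpow, one_pow, inv_one]
  obtain ⟨Ψ, hΨu, hΨΦ, hΨunr⟩ :=
    HeckeCharacter.exists_isUnitary_infiniteIdeles_eq_unramified Φ hΦu h𝔞 hker
  refine ⟨Ψ, hΨu, ?_, fun v => hΨunr v fun hle => v.isPrime.ne_top (top_le_iff.mp hle)⟩
  -- infinity type `(w, -w)`
  refine ⟨Set.univ, Filter.univ_mem, fun x _ => ?_⟩
  obtain ⟨v₀⟩ : Nonempty (InfinitePlace K) := inferInstance
  have hz := h0 x v₀
  rw [hΨΦ, hΦ, HeckeCharacter.archFactor_apply, Fintype.prod_subsingleton _ v₀, Fintype.prod_subsingleton _ v₀,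
    archUnitaryValue_neg_two_mul_eq hz, neg_neg]

/-- **STUB `stub_rangeCharacter` of skeleton v7 of crux `EisensteinHeartFlatCMInertBadKPrime` (line `hsieh_lambda`)**, proved: every
imaginary quadratic field carries a Hecke character of infinity type `(k, −k)` for some `k > 0` which is unramified at every finite
place (`k = w_K`, `exists_isUnitary_hasInfinityType_torsionOrder_unramified`). [cite: Weil1956, §1] [cite: deShalit1987, II.1.4 Lemma (ii)] -/
theorem stub_rangeCharacter :
    ∀ (K : Type) [Field K] [NumberField K], IsImaginaryQuadratic K →
      ∃ (Ψ : HeckeCharacter K) (k : ℕ), 0 < k ∧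
        Ψ.HasInfinityType (fun _ ↦ (k : ℤ)) (fun _ ↦ -(k : ℤ)) ∧
        ∀ v : HeightOneSpectrum (𝓞 K), Ψ.IsUnramifiedAt v := by
  intro K _ _ hK
  obtain ⟨Ψ, -, hΨt, hΨu⟩ := exists_isUnitary_hasInfinityType_torsionOrder_unramified hK
  exact ⟨Ψ, Units.torsionOrder K, Units.torsionOrder_pos K, hΨt, hΨu⟩

end Summit.BirchSwinnertonDyer.BirchSwinnertonDyer.Theorems.BiquadraticEisensteinDescentEisensteinHeartFlatCMInertBadKPrimeRangeCharacter

end
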